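import Summits.HodgeConjecture.HodgeConjecture.Theorems.SignSymmetricPowersFiveFacts
import Literature.AlgebraicGeometry.HodgeTheory.RestrictionImageOfCompactification
import HarnessLib

/-!
# Crux K1-B `VeryGeneralSignCommutatorsInHg` and the rung leaf `SignThreefoldPowersHodge` modulo FIVE cited facts
# with the GLOBAL INVARIANT CYCLE binder hGIC RE-CUT to Voisin II Prop. 4.23 (a SHARED, strictly smaller printed fact)
# (route `SignSymmetricPowers`, items stmt-HodgeConjecture-19716 ∕ 19715; cell `hodge-nonav`)

PROVENANCE. Cell hodge-nonav (HUMAN RULING D-0038); route owner P3 g29 GO-LOW 2026-08-28T08:13:21Z on the hGIC re-cut; written by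
the literature-typing seat `littype-FH1-2` (g19), landed by a prover seat (`--supports stmt-HodgeConjecture-19716 --as helper`;
Summits/Theorems is prover-only, D-0016). Sorry-free, no definition, no new named fact. CONDITIONAL results; nothing here says
HC ∕ HC_AV is proved; rung F-H1 is not moved.

THE RE-CUT. `SignSymmetricPowersFiveFacts.signThreefoldPowersHodge_of_five_facts` (prover-Ax g6) closes the rung leaf from
{hV, hPL, hGIC, hCDK, hB2} with hGIC = `Literature.AlgebraicGeometry.HodgeTheory.deligne_globalInvariantCycles` (Deligne, Hodge II
Thm. 4.1.1 = Voisin II Thm. 4.24, the «théorème de la partie fixe», a single-use monolithic fact of the registry). The tree has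
SINCE reduced that fact: `HodgeTheory.deligne_globalInvariantCycles_of_rangeRestrict`
(`Literature/AlgebraicGeometry/HodgeTheory/RestrictionImageOfCompactification.lean` :142) proves it from the ONE printed
statement Voisin II **Prop. 4.23** — `HodgeTheory.voisin2003_rangeRestrict_eq_of_compactification` (:84; «for `X̄` smooth
projective, `j : U ↪ X̄` Zariski open and `Y ⊂ U` a closed smooth projective subvariety, `Hᵏ(U, ℚ) → Hᵏ(Y, ℚ)` and
`Hᵏ(X̄, ℚ) → Hᵏ(Y, ℚ)` have the same image») — the Leray half (Deligne 1968 = Voisin II Thm. 4.18) being the tree THEOREM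
`deligne1968_invariantClass_fromTotalSpace_holds` and the assembly `deligne_globalInvariantCycles_assembly` being proved. Prop. 4.23
is itself reduced in the tree to its simple-normal-crossings core (`RestrictionImageOfCompactificationProofs`:
`voisin2003_rangeRestrict_eq_of_compactification_of_snc`, `…_of_complex`, `…_of_homology`, …) and is SHARED with the routes
LinearSystemTorelli ∕ PeriodDeficiency (stmt-HodgeConjecture-16363) and stub D of IdeatorFiveSketch (stmt-2409). Hence:

* `veryGeneralSignCommutatorsInHg_of_five_facts_prop423` — **K1-B ⟸ {hV, hPL, h423, hCDK, hB2}**;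
* `signThreefoldPowersHodge_of_five_facts_prop423` — the rung leaf likewise;
* `…_kernel_prop423`, `…_primitive_prop423` — the same with hV replaced by Griffiths' residue-kernel package, resp. by the
  residue package with primitivity (G5), as in the parent file.

Registry consequence (P3): `stub_globalInvariantCycles : deligne_globalInvariantCycles` of stmt-HodgeConjecture-19716 may be
re-pointed to `Literature.AlgebraicGeometry.HodgeTheory.voisin2003_rangeRestrict_eq_of_compactification` with THIS file's
compositions as the sorry-free consumer BY NAME (recipe v11 → v12).

## References

* [VoisinHodgeII2003] C. Voisin, Hodge Theory and Complex Algebraic Geometry II, CUP 2003, §4.3.3 Prop. 4.23 (printed p. 124),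
  Thm. 4.18, Thm. 4.24; §6.1.3 Thm. 6.10 ∕ Cor. 6.12.
* [DeligneHodgeII1971] P. Deligne, Théorie de Hodge II, Publ. Math. IHÉS 40 (1971), Thm. 4.1.1, Cor. 3.2.17, Thm. 2.3.5 (iii).
* [Shimada2010ZvK] I. Shimada, Generalized Zariski–van Kampen theorem …, Int. J. Math. 21 (2010), §3 Prop. 3.4.
* [CattaniDeligneKaplan1995] E. Cattani, P. Deligne, A. Kaplan, On the locus of Hodge classes, JAMS 8 (1995), Thm. 1.1, Cor. 1.2.
-/

noncomputable section

open Literature.AlgebraicGeometry.Motives Literature.AlgebraicGeometry.HodgeTheory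

-- mandated namespace `Summit.HodgeConjecture.HodgeConjecture.Theorems` trips `linter.dupNamespace` (off tree-wide)
set_option linter.dupNamespace false

namespace Summit.HodgeConjecture.HodgeConjecture.Theorems.SignSymmetricPowersFiveFactsProp423

/-- **Crux K1-B `VeryGeneralSignCommutatorsInHg` modulo FIVE cited facts, the partie fixe re-cut to Voisin II Prop. 4.23**:
{hV Voisin's equivariant eigen-Hodge numbers, hPL Picard–Lefschetz for one-nodal degenerations, h423 Prop. 4.23 (image of
restriction unchanged by a smooth compactification), hCDK Cattani–Deligne–Kaplan, hB2 Picard–Lefschetz for a symmetric `A₃` pair};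
hGIC of the parent file is supplied by the tree theorem `deligne_globalInvariantCycles_of_rangeRestrict h423` (Deligne 1968 ∕
Voisin II Thm. 4.18 being the tree theorem `deligne1968_invariantClass_fromTotalSpace_holds`). CONDITIONAL; nothing here says
HC ∕ HC_AV is proved. [cite: VoisinHodgeII2003, §4.3.3 Prop. 4.23, Thm. 4.18 and Thm. 4.24] [cite: DeligneHodgeII1971, Théorème 4.1.1]
[cite: Shimada2010ZvK, §3 Prop. 3.4] [cite: CattaniDeligneKaplan1995, Thm. 1.1 and Cor. 1.2] -/
theorem veryGeneralSignCommutatorsInHg_of_five_facts_prop423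
    (hV : Literature.AlgebraicGeometry.HodgeTheory.voisin2003_finrank_eigenspace_inf_hodgePiece_of_diagonalStabilizer)
    (hPL : Literature.AlgebraicGeometry.HodgeTheory.picardLefschetz_nodalForms_uniform)
    (h423 : Literature.AlgebraicGeometry.HodgeTheory.voisin2003_rangeRestrict_eq_of_compactification)
    (hCDK : Literature.AlgebraicGeometry.HodgeTheory.cmsp_nonHodgeGenericPoints_countable_algebraic_cover)
    (hB2 : Literature.AlgebraicGeometry.HodgeTheory.picardLefschetz_symmetricA3) :
    Summit.HodgeConjecture.HodgeConjecture.Theses.SignSymmetricPowers.VeryGeneralSignCommutatorsInHg :=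
  SignSymmetricPowersFiveFacts.veryGeneralSignCommutatorsInHg_of_five_facts @hV @hPL
    (deligne_globalInvariantCycles_of_rangeRestrict h423) @hCDK @hB2

/-- **The rung leaf `SignThreefoldPowersHodge` modulo the same FIVE cited facts** (h423 = Voisin II Prop. 4.23 in place of the
partie fixe). CONDITIONAL; rung F-H1 not moved. [cite: VoisinHodgeII2003, §4.3.3 Prop. 4.23 and Thm. 4.24]
[cite: Shimada2010ZvK, §3 Prop. 3.4] [cite: CattaniDeligneKaplan1995, Thm. 1.1 and Cor. 1.2] -/
theorem signThreefoldPowersHodge_of_five_facts_prop423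
    (hV : Literature.AlgebraicGeometry.HodgeTheory.voisin2003_finrank_eigenspace_inf_hodgePiece_of_diagonalStabilizer)
    (hPL : Literature.AlgebraicGeometry.HodgeTheory.picardLefschetz_nodalForms_uniform)
    (h423 : Literature.AlgebraicGeometry.HodgeTheory.voisin2003_rangeRestrict_eq_of_compactification)
    (hCDK : Literature.AlgebraicGeometry.HodgeTheory.cmsp_nonHodgeGenericPoints_countable_algebraic_cover)
    (hB2 : Literature.AlgebraicGeometry.HodgeTheory.picardLefschetz_symmetricA3) :
    Summit.HodgeConjecture.HodgeConjecture.Theses.SignSymmetricPowers.SignThreefoldPowersHodge :=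
  SignSymmetricPowersFiveFacts.signThreefoldPowersHodge_of_five_facts @hV @hPL
    (deligne_globalInvariantCycles_of_rangeRestrict h423) @hCDK @hB2

/-- **K1-B modulo FIVE facts, residue-kernel form, partie fixe re-cut to Prop. 4.23**: hV replaced by Griffiths' residue-kernel
package (Voisin II Thm. 6.10). CONDITIONAL. [cite: VoisinHodgeII2003, §6.1.3 Thm. 6.10 and Cor. 6.12, §4.3.3 Prop. 4.23]
[cite: Shimada2010ZvK, §3 Prop. 3.4] [cite: CattaniDeligneKaplan1995, Thm. 1.1 and Cor. 1.2] -/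
theorem veryGeneralSignCommutatorsInHg_of_five_facts_kernel_prop423
    (hG : Literature.AlgebraicGeometry.HodgeTheory.Griffiths1969_residueKernel_eq_jacobianIdeal)
    (hPL : Literature.AlgebraicGeometry.HodgeTheory.picardLefschetz_nodalForms_uniform)
    (h423 : Literature.AlgebraicGeometry.HodgeTheory.voisin2003_rangeRestrict_eq_of_compactification)
    (hCDK : Literature.AlgebraicGeometry.HodgeTheory.cmsp_nonHodgeGenericPoints_countable_algebraic_cover)
    (hB2 : Literature.AlgebraicGeometry.HodgeTheory.picardLefschetz_symmetricA3) :
    Summit.HodgeConjecture.HodgeConjecture.Theses.SignSymmetricPowers.VeryGeneralSignCommutatorsInHg :=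
  SignSymmetricPowersFiveFacts.veryGeneralSignCommutatorsInHg_of_five_facts_kernel @hG @hPL
    (deligne_globalInvariantCycles_of_rangeRestrict h423) @hCDK @hB2

/-- **K1-B modulo FIVE facts, residue-package form (G5), partie fixe re-cut to Prop. 4.23.** CONDITIONAL.
[cite: VoisinHodgeII2003, §6.1.3 Thm. 6.10 and Cor. 6.12, §6.1.2 Thm. 6.5, §4.3.3 Prop. 4.23]
[cite: Shimada2010ZvK, §3 Prop. 3.4] [cite: CattaniDeligneKaplan1995, Thm. 1.1 and Cor. 1.2] -/
theorem veryGeneralSignCommutatorsInHg_of_five_facts_primitive_prop423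
    (hG5 : Literature.AlgebraicGeometry.HodgeTheory.Griffiths1969_residues_primitive)
    (hPL : Literature.AlgebraicGeometry.HodgeTheory.picardLefschetz_nodalForms_uniform)
    (h423 : Literature.AlgebraicGeometry.HodgeTheory.voisin2003_rangeRestrict_eq_of_compactification)
    (hCDK : Literature.AlgebraicGeometry.HodgeTheory.cmsp_nonHodgeGenericPoints_countable_algebraic_cover)
    (hB2 : Literature.AlgebraicGeometry.HodgeTheory.picardLefschetz_symmetricA3) :
    Summit.HodgeConjecture.HodgeConjecture.Theses.SignSymmetricPowers.VeryGeneralSignCommutatorsInHg :=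
  SignSymmetricPowersFiveFacts.veryGeneralSignCommutatorsInHg_of_five_facts_primitive @hG5 @hPL
    (deligne_globalInvariantCycles_of_rangeRestrict h423) @hCDK @hB2

end Summit.HodgeConjecture.HodgeConjecture.Theorems.SignSymmetricPowersFiveFactsProp423

end
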